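import Literature.Geometry.Lorentzian.SchwarzschildKerrSchildComponents

/-!
# Route EIHFluxBalance — `InertialRecession` (E′), K1 / stub `stub_coerMomKernel` (Bk), far field, part F1:
# SECOND derivatives of the Schwarzschild Kerr–Schild components in closed form

Helper file for the crux `stmt-FinalStateConjecture-17403`. The far-field (order `R⁻³`, `R⁻⁴`) momentum rows of the
modulated Kerr ansatz are flat momentum-constraint expressions `Σ_i ∂_iV_ij − ∂_jΣ_iV_ii` in first-variation fields
`V = Lie_X k` of the LINEARISED Kerr–Schild tensor `k = Kerr.bilin 1 0 − η` (and of its spin dipole); they consume the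
2-jet of the Schwarzschild Kerr–Schild components. `SchwarzschildKerrSchildComponents` gives the first derivatives
(`Schwarzschild.dG`, atoms `sdot, ell, dEll`); here: the derivative of the atom `dEll` (`hasFDerivAt_dEll`,
`fderiv_dEll_apply`) and **the second derivatives `∂_W ∂_V g(A,B)` of `Kerr.bilin M 0` off the time axis in closed
form** (`fderiv_fderiv_bilin_zero_spin_apply`). No definitions, no `sorry`. [folklore]
-/

set_option linter.dupNamespace false

noncomputable section

-- instance search through the nested operator types (as in `SchwarzschildKerrSchildComponents`)
set_option maxSynthPendingDepth 3

open scoped Topology InnerProductSpace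
open Filter Set Function Literature.Geometry.Lorentzian Literature.Geometry.Lorentzian.Schwarzschild

namespace Summit.FinalStateConjecture.FinalStateConjecture.Theorems.SublinearIsFree.Slaving

variable {x : E4}

/-- `y ↦ ∂_V ℓ_y(A)` is differentiable off the time axis, with derivative the displayed continuous linear map
(Leibniz on `⟪A⃗,V⃗⟫/r − ⟪y⃗,A⃗⟫⟪y⃗,V⃗⟫/r³`). [folklore] -/
theorem hasFDerivAt_dEll (hx : E4.spatial x ≠ 0) (V A : E4) :
    HasFDerivAt (fun y : E4 ↦ dEll y V A)
      ((-(sdot A V * (1 : ℕ)) / E4.spatialNorm x ^ (1 + 2)) • sdotCLM x -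
        ((sdot x A * sdot x V) • ((-(1 * (3 : ℕ)) / E4.spatialNorm x ^ (3 + 2)) • sdotCLM x) +
          (1 / E4.spatialNorm x ^ 3) • (sdot x A • sdotCLM V + sdot x V • sdotCLM A))) x := by
  have h := (hasFDerivAt_const_div_spatialNorm_pow (sdot A V) hx 1).sub
    (((hasFDerivAt_sdot_left x A).mul (hasFDerivAt_sdot_left x V)).mul
      (hasFDerivAt_const_div_spatialNorm_pow 1 hx 3))
  have hfun : (fun y : E4 ↦ dEll y V A) =
      fun y ↦ sdot A V / E4.spatialNorm y ^ 1 - sdot y A * sdot y V * (1 / E4.spatialNorm y ^ 3) := by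
    funext y; simp only [dEll, pow_one]; ring
  rw [hfun]
  refine h.congr_fderiv ?_
  ext U
  simp only [FunLike.coe_sub, FunLike.coe_add, Pi.sub_apply, Pi.add_apply,
    FunLike.coe_smul, Pi.smul_apply, Pi.mul_apply, sdotCLM_apply, smul_eq_mul]

/-- **The derivative of the atom `∂_V ℓ(A)`**: off the time axis,
`∂_W (∂_V ℓ(A)) = −⟪A⃗,V⃗⟫⟪x⃗,W⃗⟫/r³ − (⟪A⃗,W⃗⟫⟪x⃗,V⃗⟫ + ⟪x⃗,A⃗⟫⟪V⃗,W⃗⟫)/r³ + 3⟪x⃗,A⃗⟫⟪x⃗,V⃗⟫⟪x⃗,W⃗⟫/r⁵`. [folklore] -/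
theorem fderiv_dEll_apply (hx : E4.spatial x ≠ 0) (V A W : E4) :
    fderiv ℝ (fun y : E4 ↦ dEll y V A) x W =
      -(sdot A V * sdot x W) / E4.spatialNorm x ^ 3 -
          (sdot A W * sdot x V + sdot x A * sdot V W) / E4.spatialNorm x ^ 3 +
        3 * sdot x A * sdot x V * sdot x W / E4.spatialNorm x ^ 5 := by
  have hr : E4.spatialNorm x ≠ 0 := by rwa [E4.spatialNorm, norm_ne_zero_iff]
  rw [(hasFDerivAt_dEll hx V A).fderiv]
  simp only [FunLike.coe_sub, FunLike.coe_add, Pi.sub_apply, Pi.add_apply,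
    FunLike.coe_smul, Pi.smul_apply, sdotCLM_apply, smul_eq_mul]
  rw [sdot_comm V W]
  field_simp
  push_cast
  ring

/-- **The second derivatives of the Schwarzschild Kerr–Schild components** off the time axis:
`∂_W ∂_V g(A,B)` for `g = Kerr.bilin M 0 = η + (2M/r) ℓ ⊗ ℓ`, by differentiating `Schwarzschild.dG` along `W`
(Leibniz through `∂(2M/r) = −2M⟪x⃗,·⃗⟫/r³`, `∂(−2M/r³) = 6M⟪x⃗,·⃗⟫/r⁵`, `∂ℓ = dEll`, `∂ dEll` above). [folklore] -/
theorem fderiv_fderiv_bilin_zero_spin_apply (M : ℝ) (hx : E4.spatial x ≠ 0) (V A B W : E4) :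
    fderiv ℝ (fun y : E4 ↦ fderiv ℝ (Kerr.bilin M 0) y V A B) x W =
      6 * M / E4.spatialNorm x ^ 5 * sdot x W * sdot x V * (ell x A * ell x B) +
        -(2 * M) / E4.spatialNorm x ^ 3 * sdot V W * (ell x A * ell x B) +
        -(2 * M) / E4.spatialNorm x ^ 3 * sdot x V * (dEll x W A * ell x B + ell x A * dEll x W B) +
        -(2 * M) / E4.spatialNorm x ^ 3 * sdot x W * (dEll x V A * ell x B + ell x A * dEll x V B) +
        2 * M / E4.spatialNorm x *
          ((-(sdot A V * sdot x W) / E4.spatialNorm x ^ 3 -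
                (sdot A W * sdot x V + sdot x A * sdot V W) / E4.spatialNorm x ^ 3 +
              3 * sdot x A * sdot x V * sdot x W / E4.spatialNorm x ^ 5) * ell x B +
            dEll x V A * dEll x W B + dEll x W A * dEll x V B +
            ell x A * (-(sdot B V * sdot x W) / E4.spatialNorm x ^ 3 -
                (sdot B W * sdot x V + sdot x B * sdot V W) / E4.spatialNorm x ^ 3 +
              3 * sdot x B * sdot x V * sdot x W / E4.spatialNorm x ^ 5)) := by
  have hr : E4.spatialNorm x ≠ 0 := by rwa [E4.spatialNorm, norm_ne_zero_iff]
  have heq : (fun y : E4 ↦ fderiv ℝ (Kerr.bilin M 0) y V A B) =ᶠ[𝓝 x] fun y ↦ dG M y V A B := by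
    filter_upwards [isOpen_spatial_ne_zero.mem_nhds hx] with y hy
    exact fderiv_bilin_zero_spin_apply M hy V A B
  have h1 := hasFDerivAt_const_div_spatialNorm_pow (-(2 * M)) hx 3
  have h2 := hasFDerivAt_sdot_left x V
  have hA := hasFDerivAt_ell hx A
  have hB := hasFDerivAt_ell hx B
  have hdA := hasFDerivAt_dEll hx V A
  have hdB := hasFDerivAt_dEll hx V B
  have h3 := hasFDerivAt_const_div_spatialNorm_pow (2 * M) hx 1
  have H := ((h1.mul h2).mul (hA.mul hB)).add (h3.mul ((hdA.mul hB).add (hA.mul hdB)))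
  have hfun : (fun y : E4 ↦ dG M y V A B) = fun y ↦
      -(2 * M) / E4.spatialNorm y ^ 3 * sdot y V * (ell y A * ell y B) +
        2 * M / E4.spatialNorm y ^ 1 * (dEll y V A * ell y B + ell y A * dEll y V B) := by
    funext y; simp only [dG, pow_one]
  rw [(H.congr_of_eventuallyEq (heq.trans (EventuallyEq.of_eq hfun))).fderiv]
  simp only [FunLike.coe_sub, FunLike.coe_add, Pi.sub_apply, Pi.add_apply,
    FunLike.coe_smul, Pi.smul_apply, Pi.mul_apply, sdotCLM_apply, ellFD_apply, smul_eq_mul, pow_one]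
  rw [sdot_comm V W, sdot_comm A W, sdot_comm B W]
  field_simp
  push_cast
  ring

/-- Registered carrier `slaving_schwarzschildKSHessian_slaving12` of the crux item (= `fderiv_dEll_apply`). [folklore] -/
theorem slaving_schwarzschildKSHessian_slaving12 : open Literature.Geometry.Lorentzian Literature.Geometry.Lorentzian.Schwarzschild in ∀ {x : E4}, E4.spatial x ≠ 0 → ∀ V A W : E4, fderiv ℝ (fun y : E4 ↦ dEll y V A) x W = -(sdot A V * sdot x W) / E4.spatialNorm x ^ 3 - (sdot A W * sdot x V + sdot x A * sdot V W) / E4.spatialNorm x ^ 3 + 3 * sdot x A * sdot x V * sdot x W / E4.spatialNorm x ^ 5 :=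
  fun hx V A W ↦ fderiv_dEll_apply hx V A W

end Summit.FinalStateConjecture.FinalStateConjecture.Theorems.SublinearIsFree.Slaving
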